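/-
Copyright (c) 2026 the pub-hodgecm-mathlib formalisation cell (harness21).  Prover seat hodgecm-mathlib-A-p19 (g20), topic T5 = P8
«(C♯)hol interior», node C∞ brick (W2) «vacuum coefficient of Folland's section at a sign-block-diagonal one-place element, any signature»
(census 2026-08-31T23:10Z; desk F0P2-plan (g9) 23:23Z).  KERNEL: theorems only.
-/
import Literature.NumberTheory.GelbartRogawski1991.DoubledWeilRepresentationArchPlacePhaseBlock
import Literature.NumberTheory.GelbartRogawski1991.DoubledWeilRepresentationArchPlaceVacuum
import HarnessLib

/-!
# The vacuum coefficient of Folland's section at `k_{v₀,u}` for a SIGN-BLOCK-DIAGONAL `u`, any signature at `v₀`: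
# `vac = (det R₋₋)⁻¹`, `R₋₋` the negative-class block of the scaled-frame matrix of `u ⊗ 1_W` ([Folland1989, Prop. (4.39)]; [KonnoKonno2007, Lem. 5.2])

Topic `NumberTheory/GelbartRogawski1991`; namespace `Literature.NumberTheory.GelbartRogawski1991.GRConstruction`.  KERNEL ONLY: proved theorems;
0 definitions, 0 records, 0 `sorry`.  Sequel of ★ `DoubledWeilRepresentationArchPlaceVacuum` (bricks (iii) of node Cc: `vac (sectionD k_{v₀,u}) = 1`
when the pair form is POSITIVE at `v₀`, `= ((det u)^M)⁻¹` when NEGATIVE) and of (W1) ★ `DoubledWeilRepresentationArchPlacePhaseBlock` (the place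
components of `k_{v₀,u}` are sign-block compact for a sign-block-diagonal `u` at ANY signature).  Folland's vacuum coefficient is `(∏_v det b_v)⁻¹`
(★ `vac_archWeilSectionS_of_kV`), `b_v` the NEGATIVE sign block of the place component; at `v₀` the negative indices of the doubled datum are the
first-copy indices of NEGATIVE pair sign and the second-copy indices of POSITIVE pair sign, on which `k_{v₀,u}` is `R₋₋ ⊕ 1`
(`R = reindex e e (u ⊗ 1_W)`):

* `det_reindex_kronecker_one` — `det R = (det u)^M`;
* `det_negSubmatrix_archKPlace_eq_det_submatrix_negIdx` — at `v₀` the negative-block determinant is `det R₋₋` (`R₋₋ = R.submatrix` on `NegIdx x_{v₀}`;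
  for EVERY `u`: the negative block of `(u ⊗ 1_W) ⊕ 1` is `R₋₋ ⊕ 1`);
* **`vac_sectionD_archKPlace_of_blockDiag`** — `vac (sectionD k_{v₀,u}) = (det R₋₋)⁻¹`;
* **`etaD_mul_vac_archKPlace_of_blockDiag`** — with ★ `coe_etaD_archKPlace`: `η_τ(k_{v₀,u}) · vac = ((det u)^M)^{(τ_{w(v₀)}+1)/2} · (det R₋₋)⁻¹`
  — for `M = 1` and `det u = det R₊₊ · det R₋₋` this is `(det R₊₊)^{(τ+1)/2} (det R₋₋)^{(τ−1)/2}`, [KonnoKonno2007, Lem. 5.2]'s exponents `(τ±1)/2`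
  on the two sign blocks at once; the node-C∞ closer reads it on the diagonal torus `u = diag(s)` (the integer equations posted on the P2 bus
  2026-08-31T23:27Z).  Specialises to ★ `vac_sectionD_archKPlace_of_pos` (`NegIdx x_{v₀} = ∅`) and ★ `_of_neg` (`NegIdx x_{v₀}` = everything).

HONEST SCOPE.  Statements about the tree's own Weil-representation terms; nothing of [Liu2021] is asserted.  HC_CM is NOT proved here or anywhere in
the tree.

References: [Folland1989] §4.2 Prop. (4.39); [KonnoKonno2007] §3.1, Lemma 5.2; [Kudla1994] §2 (doubled space); [Liu2021] App. D Lem. D.2 (2) (consumer).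
-/

set_option autoImplicit false

noncomputable section

open scoped Classical
open scoped Matrix Kronecker
open NumberField NumberField.InfinitePlace NumberField.mixedEmbedding IsDedekindDomain
open Literature.NumberTheory.Automorphic Literature.NumberTheory.Automorphic.UnitaryGroup
open Literature.NumberTheory.Weil1964

namespace Literature.NumberTheory.GelbartRogawski1991.GRConstruction

open UnitaryDualPair
open Literature.NumberTheory.GelbartRogawski1991.UnitaryDualPair.LocalSplitting
open Literature.RepresentationTheory.KonnoKonno2007 Literature.RepresentationTheory.KonnoKonno2007.RealDualPair
open Literature.Analysis.SegalBargmann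

variable (L : Type) [Field L] [NumberField L] [IsCMField L]

variable {N M n : ℕ} (e : Fin N × Fin M ≃ Fin n)
  (dV : Fin N → L) (hdV : ∀ i, IsCMField.complexConj L (dV i) = dV i) (hdV0 : ∀ i, dV i ≠ 0)
  (dW : Fin M → L) (hdW : ∀ i, IsCMField.complexConj L (dW i) = dW i) (hdW0 : ∀ i, dW i ≠ 0)
  (v₀ : {v : InfinitePlace (Fp L) // v.IsReal}) (u : UnitaryGroup.archLocal L N (Matrix.diagonal dV) (cmPlaceOver L v₀))

/-! ## §1 Determinants -/

/-- `det (e-reindex (u ⊗ 1_W)) = (det u)^M`. [folklore] -/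
private theorem det_reindex_kronecker_one :
    (Matrix.reindex e e
        ((((u : UnitaryGroup.archLocal L N (Matrix.diagonal dV) (cmPlaceOver L v₀)) : GL (Fin N) ℂ) : Matrix (Fin N) (Fin N) ℂ) ⊗ₖ
          (1 : Matrix (Fin M) (Fin M) ℂ))).det =
      ((((u : UnitaryGroup.archLocal L N (Matrix.diagonal dV) (cmPlaceOver L v₀)) : GL (Fin N) ℂ) : Matrix (Fin N) (Fin N) ℂ).det) ^ M := by
  rw [Matrix.det_reindex_self, Matrix.det_kronecker, Matrix.det_one, one_pow, mul_one, Fintype.card_fin]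

include hdV0 hdW0 in
/-- **at `v₀`, for every `u`: the negative-block determinant of `(k_{v₀,u})_{w(v₀)}` is `det R₋₋`**, `R₋₋` the restriction of
`R = e-reindex (u ⊗ 1_W)` to the pair indices of NEGATIVE sign (the negative indices of the doubled datum are the first-copy negatives and the
second-copy positives; on them the component is `R₋₋ ⊕ 1`; it is the determinant of a sign block of `kV` only when `u` is sign-block-diagonal).
[cite: Folland1989, §4.2 Prop. (4.39)] [cite: KonnoKonno2007, Lem. 5.2] -/
theorem det_negSubmatrix_archKPlace_eq_det_submatrix_negIdx :
    ((((UnitaryGroup.archAt (Fp L) L (IsCMField.complexConj L) (n + n) (hermD L e dV hdV dW hdW) (cmPlaceOver L v₀) (cmPlaceOver_smul L v₀)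
        (IsCMField.complexConj_ne_one L) (archKPlace L e dV hdV dW hdW v₀ u) :
        UnitaryGroup.archLocal L (n + n) (hermD L e dV hdV dW hdW) (cmPlaceOver L v₀)) : GL (Fin (n + n)) ℂ) : Matrix (Fin (n + n)) (Fin (n + n)) ℂ).submatrix
      (fun q : NegIdx (signVec (cmPlaceOver L) (entryD L e dV hdV dW hdW) (imagUnit L) v₀) => q.1)
      (fun q : NegIdx (signVec (cmPlaceOver L) (entryD L e dV hdV dW hdW) (imagUnit L) v₀) => q.1)).det =
      ((Matrix.reindex e e
          ((((u : UnitaryGroup.archLocal L N (Matrix.diagonal dV) (cmPlaceOver L v₀)) : GL (Fin N) ℂ) : Matrix (Fin N) (Fin N) ℂ) ⊗ₖ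
            (1 : Matrix (Fin M) (Fin M) ℂ))).submatrix
        (fun q : NegIdx (signVec (cmPlaceOver L) (cmGramEntry L e dV hdV dW hdW) (imagUnit L) v₀) => q.1)
        (fun q : NegIdx (signVec (cmPlaceOver L) (cmGramEntry L e dV hdV dW hdW) (imagUnit L) v₀) => q.1)).det := by
  -- the negative indices of the doubled datum: first-copy negatives ⊔ second-copy positives
  have hinl : ∀ q : NegIdx (signVec (cmPlaceOver L) (cmGramEntry L e dV hdV dW hdW) (imagUnit L) v₀),
      ¬ 0 < signVec (cmPlaceOver L) (entryD L e dV hdV dW hdW) (imagUnit L) v₀ ((e₂ (n := n)) (Sum.inl q.1)) := fun q => by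
    rw [signVec_doubled_inl]; exact q.2
  have hinr : ∀ p : PosIdx (signVec (cmPlaceOver L) (cmGramEntry L e dV hdV dW hdW) (imagUnit L) v₀),
      ¬ 0 < signVec (cmPlaceOver L) (entryD L e dV hdV dW hdW) (imagUnit L) v₀ ((e₂ (n := n)) (Sum.inr p.1)) := fun p => by
    rw [signVec_doubled_inr, neg_pos, not_lt]; exact p.2.le
  let φf : NegIdx (signVec (cmPlaceOver L) (cmGramEntry L e dV hdV dW hdW) (imagUnit L) v₀) ⊕
      PosIdx (signVec (cmPlaceOver L) (cmGramEntry L e dV hdV dW hdW) (imagUnit L) v₀) →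
      NegIdx (signVec (cmPlaceOver L) (entryD L e dV hdV dW hdW) (imagUnit L) v₀) :=
    fun x => Sum.elim (fun q => ⟨(e₂ (n := n)) (Sum.inl q.1), hinl q⟩) (fun p => ⟨(e₂ (n := n)) (Sum.inr p.1), hinr p⟩) x
  have hφinj : Function.Injective φf := by
    rintro (q | p) (q' | p') h
    · have h' := congrArg Subtype.val h
      exact congrArg Sum.inl (Subtype.ext (Sum.inl_injective ((e₂ (n := n)).injective h')))
    · have h' : (e₂ (n := n)) (Sum.inl q.1) = (e₂ (n := n)) (Sum.inr p'.1) := congrArg Subtype.val h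
      exact absurd ((e₂ (n := n)).injective h') Sum.inl_ne_inr
    · have h' : (e₂ (n := n)) (Sum.inr p.1) = (e₂ (n := n)) (Sum.inl q'.1) := congrArg Subtype.val h
      exact absurd ((e₂ (n := n)).injective h') Sum.inr_ne_inl
    · have h' := congrArg Subtype.val h
      exact congrArg Sum.inr (Subtype.ext (Sum.inr_injective ((e₂ (n := n)).injective h')))
  have hφsurj : Function.Surjective φf := by
    rintro ⟨k, hk⟩
    obtain ⟨x, rfl⟩ := (e₂ (n := n)).surjective k
    rcases x with a | a
    · rw [signVec_doubled_inl] at hk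
      exact ⟨Sum.inl ⟨a, hk⟩, rfl⟩
    · rw [signVec_doubled_inr, neg_pos, not_lt] at hk
      have ha : 0 < signVec (cmPlaceOver L) (cmGramEntry L e dV hdV dW hdW) (imagUnit L) v₀ a :=
        lt_of_le_of_ne hk (Ne.symm (signVec_ne_zero (IsCMField.complexConj_ne_one L) (cmPlaceOver_smul L)
          (complexConj_imagUnit L) (imagUnit_ne_zero L) (cmGramEntry_ne_zero L e dV hdV dW hdW hdV0 hdW0) v₀ a))
      exact ⟨Sum.inr ⟨a, ha⟩, rfl⟩
  let φ := Equiv.ofBijective φf ⟨hφinj, hφsurj⟩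
  have hφl : ∀ q, ((φ (Sum.inl q) : NegIdx (signVec (cmPlaceOver L) (entryD L e dV hdV dW hdW) (imagUnit L) v₀)) : Fin (n + n)) =
      (e₂ (n := n)) (Sum.inl q.1) := fun q => rfl
  have hφr : ∀ p, ((φ (Sum.inr p) : NegIdx (signVec (cmPlaceOver L) (entryD L e dV hdV dW hdW) (imagUnit L) v₀)) : Fin (n + n)) =
      (e₂ (n := n)) (Sum.inr p.1) := fun p => rfl
  rw [← Matrix.det_submatrix_equiv_self φ, Matrix.submatrix_submatrix]
  -- on `NegIdx x ⊕ PosIdx x` the component is `R₋₋ ⊕ 1`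
  have h1 : ((((UnitaryGroup.archAt (Fp L) L (IsCMField.complexConj L) (n + n) (hermD L e dV hdV dW hdW) (cmPlaceOver L v₀) (cmPlaceOver_smul L v₀)
        (IsCMField.complexConj_ne_one L) (archKPlace L e dV hdV dW hdW v₀ u) :
        UnitaryGroup.archLocal L (n + n) (hermD L e dV hdV dW hdW) (cmPlaceOver L v₀)) : GL (Fin (n + n)) ℂ) : Matrix (Fin (n + n)) (Fin (n + n)) ℂ).submatrix
      ((fun q : NegIdx (signVec (cmPlaceOver L) (entryD L e dV hdV dW hdW) (imagUnit L) v₀) => q.1) ∘ φ)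
      ((fun q : NegIdx (signVec (cmPlaceOver L) (entryD L e dV hdV dW hdW) (imagUnit L) v₀) => q.1) ∘ φ)) =
      Matrix.fromBlocks
        ((Matrix.reindex e e
          ((((u : UnitaryGroup.archLocal L N (Matrix.diagonal dV) (cmPlaceOver L v₀)) : GL (Fin N) ℂ) : Matrix (Fin N) (Fin N) ℂ) ⊗ₖ
            (1 : Matrix (Fin M) (Fin M) ℂ))).submatrix
          (fun q : NegIdx (signVec (cmPlaceOver L) (cmGramEntry L e dV hdV dW hdW) (imagUnit L) v₀) => q.1)
          (fun q : NegIdx (signVec (cmPlaceOver L) (cmGramEntry L e dV hdV dW hdW) (imagUnit L) v₀) => q.1))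
        0 0 1 := by
    ext x y
    rw [Matrix.submatrix_apply, Function.comp_apply, Function.comp_apply, coe_archAt_archKPlace]
    erw [UnitaryGroup.archAt_archSingle_self (Fp L) L (IsCMField.complexConj L) N (Matrix.diagonal dV) (IsCMField.complexConj_ne_one L)
      (complexConj_smul_infinitePlace L) (cmPlaceOver L v₀) u]
    rcases x with q | p <;> rcases y with q' | p'
    · rw [hφl, hφl, Matrix.reindex_apply, Matrix.submatrix_apply, Equiv.symm_apply_apply, Equiv.symm_apply_apply, Matrix.fromBlocks_apply₁₁,
        Matrix.fromBlocks_apply₁₁, Matrix.submatrix_apply, Matrix.reindex_apply]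
    · rw [hφl, hφr, Matrix.reindex_apply, Matrix.submatrix_apply, Equiv.symm_apply_apply, Equiv.symm_apply_apply, Matrix.fromBlocks_apply₁₂,
        Matrix.fromBlocks_apply₁₂, Matrix.zero_apply, Matrix.zero_apply]
    · rw [hφr, hφl, Matrix.reindex_apply, Matrix.submatrix_apply, Equiv.symm_apply_apply, Equiv.symm_apply_apply, Matrix.fromBlocks_apply₂₁,
        Matrix.fromBlocks_apply₂₁, Matrix.zero_apply, Matrix.zero_apply]
    · rw [hφr, hφr, Matrix.reindex_apply, Matrix.submatrix_apply, Equiv.symm_apply_apply, Equiv.symm_apply_apply, Matrix.fromBlocks_apply₂₂,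
        Matrix.fromBlocks_apply₂₂, Matrix.one_apply, Matrix.one_apply]
      simp only [Subtype.ext_iff]
  rw [h1, Matrix.det_fromBlocks_zero₂₁, Matrix.det_one, mul_one]

/-! ## §2 The vacuum coefficient -/

include hdV0 hdW0 in
/-- **`u` SIGN-BLOCK-DIAGONAL at `v₀`, any signature: `vac (sectionD k_{v₀,u}) = (det R₋₋)⁻¹`**, `R₋₋` the negative-class block of
`R = e-reindex (u ⊗ 1_W)` (★ `vac_archWeilSectionS_of_kV` + §1; away from `v₀` the negative blocks are `1`, ★ `det_negSubmatrix_archKPlace_of_ne`).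
[cite: Folland1989, §4.2 Prop. (4.39)] [cite: KonnoKonno2007, Lem. 5.2] -/
theorem vac_sectionD_archKPlace_of_blockDiag
    (hblk : ∀ k k' : Fin n, 0 < signVec (cmPlaceOver L) (cmGramEntry L e dV hdV dW hdW) (imagUnit L) v₀ k →
      ¬ 0 < signVec (cmPlaceOver L) (cmGramEntry L e dV hdV dW hdW) (imagUnit L) v₀ k' →
      Matrix.reindex e e
          ((((u : UnitaryGroup.archLocal L N (Matrix.diagonal dV) (cmPlaceOver L v₀)) : GL (Fin N) ℂ) : Matrix (Fin N) (Fin N) ℂ) ⊗ₖ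
            (1 : Matrix (Fin M) (Fin M) ℂ)) k k' = 0 ∧
      Matrix.reindex e e
          ((((u : UnitaryGroup.archLocal L N (Matrix.diagonal dV) (cmPlaceOver L v₀)) : GL (Fin N) ℂ) : Matrix (Fin N) (Fin N) ℂ) ⊗ₖ
            (1 : Matrix (Fin M) (Fin M) ℂ)) k' k = 0) :
    MpS.vac (sectionD L e dV hdV hdV0 dW hdW hdW0 (archKPlace L e dV hdV dW hdW v₀ u)) =
      (((Matrix.reindex e e
          ((((u : UnitaryGroup.archLocal L N (Matrix.diagonal dV) (cmPlaceOver L v₀)) : GL (Fin N) ℂ) : Matrix (Fin N) (Fin N) ℂ) ⊗ₖ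
            (1 : Matrix (Fin M) (Fin M) ℂ))).submatrix
        (fun q : NegIdx (signVec (cmPlaceOver L) (cmGramEntry L e dV hdV dW hdW) (imagUnit L) v₀) => q.1)
        (fun q : NegIdx (signVec (cmPlaceOver L) (cmGramEntry L e dV hdV dW hdW) (imagUnit L) v₀) => q.1)).det)⁻¹ := by
  choose k hk hk1 hk2 using fun v => det_of_archUFormPi_eq_kV_of_sign_separated L (IsCMField.complexConj L) (n + n)
    (IsCMField.complexConj_ne_one L) (cmPlaceOver L) (cmPlaceOver_smul L) (cmPlaceOver_comap L) (entryD L e dV hdV dW hdW)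
    (gramD_gram_realDiagonal_entry_ne_zero L e dV hdV dW hdW hdV0 hdW0) (gramD_eq_diagonal_cm L e dV hdV dW hdW)
    (J := hermD L e dV hdV dW hdW) rfl (complexConj_imagUnit L) (imagUnit_ne_zero L) (archKPlace L e dV hdV dW hdW v₀ u) v
    (archAt_archKPlace_sign_separated_of_blockDiag L e dV hdV dW hdW v₀ u hblk v)
  rw [show MpS.vac (sectionD L e dV hdV hdV0 dW hdW hdW0 (archKPlace L e dV hdV dW hdW v₀ u)) = _ from
    vac_archWeilSectionS_of_kV L (IsCMField.complexConj L) (n + n) (IsCMField.complexConj_ne_one L) (cmPlaceOver L)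
      (cmPlaceOver_smul L) (cmPlaceOver_comap L) (entryD L e dV hdV dW hdW)
      (gramD_gram_realDiagonal_entry_ne_zero L e dV hdV dW hdW hdV0 hdW0) (gramD_eq_diagonal_cm L e dV hdV dW hdW)
      (J := hermD L e dV hdV dW hdW) rfl (complexConj_imagUnit L) (imagUnit_ne_zero L) (archKPlace L e dV hdV dW hdW v₀ u)
      (fun v => (k v).1) (fun v => (k v).2) (fun v => hk v)]
  congr 1
  rw [Finset.prod_eq_single v₀]
  · rw [hk2 v₀]; exact det_negSubmatrix_archKPlace_eq_det_submatrix_negIdx L e dV hdV hdV0 dW hdW hdW0 v₀ u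
  · intro v _ hv; rw [hk2 v]; exact det_negSubmatrix_archKPlace_of_ne L e dV hdV dW hdW v₀ u hv
  · intro h; exact absurd (Finset.mem_univ v₀) h

include hdV0 hdW0 in
/-- **`η_τ(k_{v₀,u}) · vac (sectionD k_{v₀,u}) = ((det u)^M)^{(τ_{w(v₀)}+1)/2} · (det R₋₋)⁻¹`** for a sign-block-diagonal `u` at `v₀` (★ `coe_etaD_archKPlace`
+ `vac_sectionD_archKPlace_of_blockDiag`) — the Gaussian eigenvalue of ★ T2 at the one-place element of the block-compact subgroup of an indefinite
place; `M = 1`, `det u = det R₊₊ · det R₋₋` give [KonnoKonno2007, Lem. 5.2]'s `(det R₊₊)^{(τ+1)/2} (det R₋₋)^{(τ−1)/2}`.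
[cite: KonnoKonno2007, Lem. 5.2] [cite: Folland1989, §4.2 Prop. (4.39)] -/
theorem etaD_mul_vac_archKPlace_of_blockDiag (τ : InfinitePlace L → ℤ)
    (hblk : ∀ k k' : Fin n, 0 < signVec (cmPlaceOver L) (cmGramEntry L e dV hdV dW hdW) (imagUnit L) v₀ k →
      ¬ 0 < signVec (cmPlaceOver L) (cmGramEntry L e dV hdV dW hdW) (imagUnit L) v₀ k' →
      Matrix.reindex e e
          ((((u : UnitaryGroup.archLocal L N (Matrix.diagonal dV) (cmPlaceOver L v₀)) : GL (Fin N) ℂ) : Matrix (Fin N) (Fin N) ℂ) ⊗ₖ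
            (1 : Matrix (Fin M) (Fin M) ℂ)) k k' = 0 ∧
      Matrix.reindex e e
          ((((u : UnitaryGroup.archLocal L N (Matrix.diagonal dV) (cmPlaceOver L v₀)) : GL (Fin N) ℂ) : Matrix (Fin N) (Fin N) ℂ) ⊗ₖ
            (1 : Matrix (Fin M) (Fin M) ℂ)) k' k = 0) :
    ((etaD L e dV hdV dW hdW τ (archKPlace L e dV hdV dW hdW v₀ u) : ℂˣ) : ℂ) *
        MpS.vac (sectionD L e dV hdV hdV0 dW hdW hdW0 (archKPlace L e dV hdV dW hdW v₀ u)) =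
      (((((u : UnitaryGroup.archLocal L N (Matrix.diagonal dV) (cmPlaceOver L v₀)) : GL (Fin N) ℂ) : Matrix (Fin N) (Fin N) ℂ).det) ^ M) ^
          ((τ (cmPlaceOver L v₀).1 + 1) / 2) *
        (((Matrix.reindex e e
            ((((u : UnitaryGroup.archLocal L N (Matrix.diagonal dV) (cmPlaceOver L v₀)) : GL (Fin N) ℂ) : Matrix (Fin N) (Fin N) ℂ) ⊗ₖ
              (1 : Matrix (Fin M) (Fin M) ℂ))).submatrix
          (fun q : NegIdx (signVec (cmPlaceOver L) (cmGramEntry L e dV hdV dW hdW) (imagUnit L) v₀) => q.1)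
          (fun q : NegIdx (signVec (cmPlaceOver L) (cmGramEntry L e dV hdV dW hdW) (imagUnit L) v₀) => q.1)).det)⁻¹ := by
  rw [coe_etaD_archKPlace, vac_sectionD_archKPlace_of_blockDiag L e dV hdV hdV0 dW hdW hdW0 v₀ u hblk]

end Literature.NumberTheory.GelbartRogawski1991.GRConstruction

end
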